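import Mathlib

/-!
# The abstract port problem of THEOREM R (mine-3, proofs/C-041.md §3 / §6): definitions and the gate facts (p6, gen 23)

mine-3's THEOREM R reduces ROW C-041 `(G⅔)` on the sources with internally red-connected attachments, per colouring of
`G⁺ = H − {1, 2}`, to an ABSTRACT PORT PROBLEM (C-041.md §6 (a), singleton version): a connected graph `adj` on a finite
vertex type with a root `c`, a set `M` of PORTS (`c ∉ M`), for each port the flags `k₁ p`, `k₂ p` (it carries a 1-edge /
a 2-edge; at most one of each in this version) and `sw p` (switchable: its terminal edges may be blue).  A PATTERN colours
the terminal edges (`x : P.Term → Bool`, `true` = red); it is ADMISSIBLE when every edge of a non-switchable port is red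
and no port has both a blue 1-edge and a blue 2-edge.  `A_t x` = the ports with a blue `t`-edge (DELETED on side `t`),
`X_t x` = some red `t`-edge exists, `Good₁ x` = some port with a red 2-edge is reached from `c` by a path avoiding `A₁ x`
(`Good₂` symmetric), and the weight sums are
  `Φ∨ P = Σ_{x admissible, X₁ ∨ X₂} (3·[Good₁] + 3·[Good₂] − 2)`,  `Φ∧ P` the same with `X₁ ∧ X₂`.
THE LEMMA of §3 / §6 (b) is `0 ≤ Φ∨ P` and `0 ≤ Φ∧ P` for every connected `P`; it is NOT proved here.  This file has the
definitions and the facts its proof starts from: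

* `Reach` (a path avoiding a vertex set; the cell's `WalkAvoiding` shape), `reach_anti` (S2), `Reach.trans`, the ends;
* `good₁_X₂`, `good₂_X₁` (S3: a Good pattern has a red edge to the other terminal);
* `R₀` (the port-free reach of `c`), the GATES `E₀` (the ports adjacent to `R₀`), `gates_nonempty` (S1: a connected
  problem with a port has a gate — the first port on a path from `c`), and the KEY FACT `reach_gate`: a gate not in `A`
  is reached from `c` avoiding `A` for every `A ⊆ M`;
* `weight_nonneg_of_forced_gate` / `phi_or_nonneg_of_forced_gate` / `phi_and_nonneg_of_forced_gate` — CASE (iii) of the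
  LEMMA: a non-switchable gate gives every admissible pattern a Good side, so `Φ ≥ 0`.

The remaining cases ((ii) a two-type switchable gate, (iv) pure-type gates, (v) the unique one-edge gate and the
sub-problem `Γ − R₀` rooted at it) are the successor's work (proofs/P6-THEOREM-R-LEAN-PLAN.md).  Own twin of the
definitions (lean-drafts/p6/g23/twin/portprob.py): `Φ∨, Φ∧ ≥ 0` on 3,000 random connected instances and the exact
identity `Φ = N′ + Φ′` of case (v) in all 352 instances of that case.
-/

namespace PercRepro

namespace PortProblem

open Finset

/-- A port problem (singleton version): a symmetric adjacency on `V`, a root `c`, a finite port set `M ∌ c`, the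
terminal flags `k₁ k₂` (a 1-edge / a 2-edge at the port), the switchability `sw`; every port carries a terminal edge. -/
structure Problem (V : Type*) where
  /-- the graph -/
  adj : V → V → Prop
  /-- the graph is undirected -/
  symm : ∀ x y, adj x y → adj y x
  /-- the root (the probe's red cluster is rooted at `c`) -/
  c : V
  /-- the ports -/
  M : Finset V
  /-- the root is not a port -/
  hc : c ∉ M
  /-- the port has a 1-edge -/
  k₁ : V → Bool
  /-- the port has a 2-edge -/
  k₂ : V → Bool
  /-- the port is switchable (its terminal edges may be blue) -/
  sw : V → Bool
  /-- every port has a terminal edge -/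
  hk : ∀ p ∈ M, k₁ p = true ∨ k₂ p = true

namespace Problem

variable {V : Type*}

/-- The terminal edges: `(p, false)` = the 1-edge at the port `p`, `(p, true)` = its 2-edge. -/
abbrev Term (P : Problem V) : Type _ :=
  {pt : V × Bool // pt.1 ∈ P.M ∧ (pt.2 = false → P.k₁ pt.1 = true) ∧ (pt.2 = true → P.k₂ pt.1 = true)}

/-- A pattern is admissible when every edge of a non-switchable port is red and no port carries a blue 1-edge
together with a blue 2-edge. -/
def Adm (P : Problem V) (x : P.Term → Bool) : Prop :=
  (∀ e : P.Term, P.sw e.1.1 = false → x e = true) ∧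
  (∀ e f : P.Term, e.1.1 = f.1.1 → e.1.2 = false → f.1.2 = true → x e = true ∨ x f = true)

/-- The ports in state `1`: a blue 1-edge. -/
def A₁ (P : Problem V) (x : P.Term → Bool) : Set V := {p | ∃ e : P.Term, e.1 = (p, false) ∧ x e = false}

/-- The ports in state `2`: a blue 2-edge. -/
def A₂ (P : Problem V) (x : P.Term → Bool) : Set V := {p | ∃ e : P.Term, e.1 = (p, true) ∧ x e = false}

/-- `P.Reach A u v`: a path from `u` to `v` in the graph none of whose vertices lies in `A`. -/
def Reach (P : Problem V) (A : Set V) (u v : V) : Prop :=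
  u ∉ A ∧ Relation.ReflTransGen (fun a b => P.adj a b ∧ b ∉ A) u v

/-- Some red 1-edge. -/
def X₁ (P : Problem V) (x : P.Term → Bool) : Prop := ∃ e : P.Term, e.1.2 = false ∧ x e = true

/-- Some red 2-edge. -/
def X₂ (P : Problem V) (x : P.Term → Bool) : Prop := ∃ e : P.Term, e.1.2 = true ∧ x e = true

/-- `Good₁`: a port with a red 2-edge is reached from `c` avoiding the ports deleted on side `1`. -/
def Good₁ (P : Problem V) (x : P.Term → Bool) : Prop :=
  ∃ e : P.Term, e.1.2 = true ∧ x e = true ∧ P.Reach (P.A₁ x) P.c e.1.1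

/-- `Good₂`: a port with a red 1-edge is reached from `c` avoiding the ports deleted on side `2`. -/
def Good₂ (P : Problem V) (x : P.Term → Bool) : Prop :=
  ∃ e : P.Term, e.1.2 = false ∧ x e = true ∧ P.Reach (P.A₂ x) P.c e.1.1

open Classical in
/-- The weight of a pattern: `3·[Good₁] + 3·[Good₂] − 2`. -/
noncomputable def weight (P : Problem V) (x : P.Term → Bool) : ℤ :=
  (if P.Good₁ x then 3 else 0) + (if P.Good₂ x then 3 else 0) - 2

/-- The port-free reach `R₀` of the root. -/
def R₀ (P : Problem V) : Set V := {v | P.Reach (↑P.M) P.c v}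

/-- The gates: the ports adjacent to the port-free reach. -/
def IsGate (P : Problem V) (p : V) : Prop := p ∈ P.M ∧ ∃ r ∈ P.R₀, P.adj r p

/-- A connected problem: every vertex is reached from the root. -/
def Connected (P : Problem V) : Prop := ∀ v, Relation.ReflTransGen P.adj P.c v

section Basic

variable {P : Problem V}

/-- **S2**: avoiding more is harder. -/
theorem reach_anti {A B : Set V} (hAB : A ⊆ B) {u v : V} (h : P.Reach B u v) : P.Reach A u v := by
  obtain ⟨hu, hw⟩ := h
  refine ⟨fun hu' => hu (hAB hu'), ?_⟩
  induction hw with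
  | refl => exact Relation.ReflTransGen.refl
  | tail _ hbc ih => exact ih.tail ⟨hbc.1, fun hb => hbc.2 (hAB hb)⟩

/-- The end of an avoiding path is not in the avoided set. -/
theorem Reach.end_not_mem {A : Set V} {u v : V} (h : P.Reach A u v) : v ∉ A := by
  rcases Relation.ReflTransGen.cases_tail h.2 with h' | ⟨_, _, hbc⟩
  · exact h' ▸ h.1
  · exact hbc.2

/-- Avoiding paths compose. -/
theorem Reach.trans {A : Set V} {u v w : V} (h₁ : P.Reach A u v) (h₂ : P.Reach A v w) :
    P.Reach A u w :=
  ⟨h₁.1, h₁.2.trans h₂.2⟩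

/-- A single step. -/
theorem Reach.single {A : Set V} {u v : V} (hu : u ∉ A) (hv : v ∉ A) (h : P.adj u v) :
    P.Reach A u v :=
  ⟨hu, Relation.ReflTransGen.single ⟨h, hv⟩⟩

/-- An avoiding path is a path. -/
theorem Reach.reflTransGen {A : Set V} {u v : V} (h : P.Reach A u v) :
    Relation.ReflTransGen P.adj u v := by
  obtain ⟨_, hw⟩ := h
  induction hw with
  | refl => exact Relation.ReflTransGen.refl
  | tail _ hbc ih => exact ih.tail hbc.1

/-- **S3**: `Good₁` gives a red 2-edge. -/
theorem good₁_X₂ {x : P.Term → Bool} (h : P.Good₁ x) : P.X₂ x := by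
  obtain ⟨e, he, hx, _⟩ := h
  exact ⟨e, he, hx⟩

/-- **S3**: `Good₂` gives a red 1-edge. -/
theorem good₂_X₁ {x : P.Term → Bool} (h : P.Good₂ x) : P.X₁ x := by
  obtain ⟨e, he, hx, _⟩ := h
  exact ⟨e, he, hx⟩

/-- The deleted ports are ports. -/
theorem A₁_subset (x : P.Term → Bool) : P.A₁ x ⊆ ↑P.M := by
  rintro p ⟨e, he, _⟩
  have h := e.2.1
  rw [he] at h
  exact h

/-- The deleted ports are ports. -/
theorem A₂_subset (x : P.Term → Bool) : P.A₂ x ⊆ ↑P.M := by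
  rintro p ⟨e, he, _⟩
  have h := e.2.1
  rw [he] at h
  exact h

/-- The root is in its port-free reach. -/
theorem c_mem_R₀ : P.c ∈ P.R₀ := ⟨P.hc, Relation.ReflTransGen.refl⟩

/-- The port-free reach contains no port. -/
theorem not_mem_M_of_mem_R₀ {v : V} (hv : v ∈ P.R₀) : v ∉ P.M := Reach.end_not_mem hv

/-- **The first port on a path**: a path from the root to a port passes a first port, which is a gate. -/
theorem exists_gate_of_reflTransGen {p : V} (hp : p ∈ P.M)
    (h : Relation.ReflTransGen P.adj P.c p) : ∃ q, P.IsGate q := by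
  -- induct from the root: the prefix stays in `R₀` until the first port
  have key : ∀ v, Relation.ReflTransGen P.adj P.c v → v ∈ P.R₀ ∨ ∃ q, P.IsGate q := by
    intro v hv
    induction hv with
    | refl => exact Or.inl c_mem_R₀
    | @tail b d _ hbd ih =>
      rcases ih with hb | hq
      · by_cases hd : d ∈ P.M
        · exact Or.inr ⟨d, hd, b, hb, hbd⟩
        · exact Or.inl ⟨hb.1, hb.2.tail ⟨hbd, hd⟩⟩
      · exact Or.inr hq
  rcases key p h with hpR | hq
  · exact absurd hp (not_mem_M_of_mem_R₀ hpR)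
  · exact hq

/-- **S1**: a connected problem with a port has a gate. -/
theorem gates_nonempty (hconn : P.Connected) (hM : P.M.Nonempty) : ∃ q, P.IsGate q := by
  obtain ⟨p, hp⟩ := hM
  exact exists_gate_of_reflTransGen hp (hconn p)

/-- **THE KEY FACT**: a gate outside `A ⊆ M` is reached from the root avoiding `A` — the port-free path to its
`R₀`-neighbour meets no port, hence nothing of `A`. -/
theorem reach_gate {A : Set V} (hAM : A ⊆ ↑P.M) {p : V} (hp : P.IsGate p) (hpA : p ∉ A) :
    P.Reach A P.c p := by
  obtain ⟨_, r, hr, hrp⟩ := hp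
  have hr' : P.Reach A P.c r := reach_anti hAM hr
  exact hr'.trans (Reach.single hr'.end_not_mem hpA hrp)

/-- A gate is a port. -/
theorem IsGate.mem {p : V} (hp : P.IsGate p) : p ∈ P.M := hp.1

end Basic

/-! ### Case (iii): a forced-free gate -/

section Forced

variable {P : Problem V}

/-- A non-switchable port has all its edges red in an admissible pattern, so it is deleted on no side. -/
theorem not_mem_A₁_of_forced {x : P.Term → Bool} (hx : P.Adm x) {p : V} (hp : P.sw p = false) :
    p ∉ P.A₁ x := by
  rintro ⟨e, he, hxe⟩
  have h1 : e.1.1 = p := by rw [he]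
  have := hx.1 e (h1 ▸ hp)
  rw [this] at hxe
  exact absurd hxe (by decide)

/-- A non-switchable port has all its edges red in an admissible pattern, so it is deleted on no side. -/
theorem not_mem_A₂_of_forced {x : P.Term → Bool} (hx : P.Adm x) {p : V} (hp : P.sw p = false) :
    p ∉ P.A₂ x := by
  rintro ⟨e, he, hxe⟩
  have h1 : e.1.1 = p := by rw [he]
  have := hx.1 e (h1 ▸ hp)
  rw [this] at hxe
  exact absurd hxe (by decide)

/-- **Case (iii)**: a non-switchable gate makes every admissible pattern Good on a side. -/
theorem good_of_forced_gate {x : P.Term → Bool} (hx : P.Adm x) {p : V} (hp : P.IsGate p)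
    (hsw : P.sw p = false) : P.Good₁ x ∨ P.Good₂ x := by
  rcases P.hk p hp.mem with hk | hk
  · -- a red 1-edge at `p`, reached avoiding `A₂ x`
    right
    let e : P.Term := ⟨(p, false), hp.mem, fun _ => hk, fun h => Bool.noConfusion h⟩
    refine ⟨e, rfl, hx.1 e hsw, ?_⟩
    exact reach_gate (A₂_subset x) hp (not_mem_A₂_of_forced hx hsw)
  · left
    let e : P.Term := ⟨(p, true), hp.mem, fun h => Bool.noConfusion h, fun _ => hk⟩
    refine ⟨e, rfl, hx.1 e hsw, ?_⟩
    exact reach_gate (A₁_subset x) hp (not_mem_A₁_of_forced hx hsw)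

open Classical in
/-- **Case (iii), the weights**: with a non-switchable gate every admissible pattern has weight `≥ 1`. -/
theorem one_le_weight_of_forced_gate {x : P.Term → Bool} (hx : P.Adm x) {p : V} (hp : P.IsGate p)
    (hsw : P.sw p = false) : 1 ≤ P.weight x := by
  unfold weight
  rcases good_of_forced_gate hx hp hsw with h | h
  · rw [if_pos h]
    split_ifs <;> omega
  · rw [if_pos h]
    split_ifs <;> omega

end Forced

section Sums

variable [Fintype V] [DecidableEq V] {P : Problem V}

open Classical in
/-- `Φ∨ P`: the weight sum over the admissible patterns with a red terminal edge (`X₁ ∨ X₂`). -/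
noncomputable def phiOr (P : Problem V) : ℤ :=
  ∑ x : P.Term → Bool, if P.Adm x ∧ (P.X₁ x ∨ P.X₂ x) then P.weight x else 0

open Classical in
/-- `Φ∧ P`: the weight sum over the admissible patterns with a red 1-edge and a red 2-edge (`X₁ ∧ X₂`). -/
noncomputable def phiAnd (P : Problem V) : ℤ :=
  ∑ x : P.Term → Bool, if P.Adm x ∧ (P.X₁ x ∧ P.X₂ x) then P.weight x else 0

open Classical in
/-- **Case (iii) of the LEMMA**: `0 ≤ Φ∨ P` when some gate is non-switchable. -/
theorem phiOr_nonneg_of_forced_gate {p : V} (hp : P.IsGate p) (hsw : P.sw p = false) :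
    0 ≤ P.phiOr := by
  unfold phiOr
  apply Finset.sum_nonneg
  intro x _
  split_ifs with h
  · have := one_le_weight_of_forced_gate h.1 hp hsw
    omega
  · exact le_rfl

open Classical in
/-- **Case (iii) of the LEMMA**: `0 ≤ Φ∧ P` when some gate is non-switchable. -/
theorem phiAnd_nonneg_of_forced_gate {p : V} (hp : P.IsGate p) (hsw : P.sw p = false) :
    0 ≤ P.phiAnd := by
  unfold phiAnd
  apply Finset.sum_nonneg
  intro x _
  split_ifs with h
  · have := one_le_weight_of_forced_gate h.1 hp hsw
    omega
  · exact le_rfl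

end Sums

end Problem

end PortProblem

end PercRepro
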